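import Mathlib
import HarnessLib
import Summits.HubbardSuperconductivity.HubbardSuperconductivity.Theorems.KLProgrammeKLRegimeSplitEdgeFactsRegimeJets
import Summits.HubbardSuperconductivity.HubbardSuperconductivity.Theorems.KLProgrammeKLRegimeSplitEdgeFactsDeepScaleSums
import Summits.HubbardSuperconductivity.HubbardSuperconductivity.Theorems.KLProgrammeKLRegimeSplitEdgeFactsTransferLines
import Summits.HubbardSuperconductivity.HubbardSuperconductivity.Theorems.KLProgrammeKLRegimeSplitEdgeFactsComplFamily
import Summits.HubbardSuperconductivity.HubbardSuperconductivity.Theorems.KLProgrammeKLRegimeSplitPairLadder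

/-!
# Route `KLProgramme` — edge facts for the pair masses ACROSS TRANSFERS, XXIII: the (D2) SHORTFALL BY VALUE for the complementary members —
# `Σ_{j<m} (W₀(j) − W_Q(j)) ≤ 575263 + 2¹⁷·(#edge scales)` in a pair class, for ANY member assignment `j ↦ s_{j, m_j}` and ANY admissible frames `j ↦ K_j`

Cell gate-hubbard-kl, seat hubbard-kl-k3c1-p1 (g22; child-1 lineage).  E1 docket (3)/(5′)(s2), (D2) half (S2-ROWS.md §2: `Σ_{j<m}(W₀(j) − W_q(j)) ≤ Θ`, only an
UPPER bound, sign free).  With the regime-keyed (D2)-deep row (`…RegimeJets.klrg_abs_sum_klTransferWeight_sub_pin_le_numeric`), the deep condition from the pair class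
(`klrg_deep_of_isPairClassAt_seven`), the geometric sum over deep scales (`…DeepScaleSums.klds_sum_sq_div_klScale_le`) and p1's mass ENVELOPE
(`sum_abs_klTransferWeight_le_of_frameOK`: `Σ_p |t_n[φ](Q,p)| ≤ 2¹⁶` for `0 ≤ φ ≤ 1 − w_{Λ_n}`), the shortfall closes BY VALUE, modulo only the NAMING (N): for masses
`W_q(j) := −Σ_p t_j^{K_j}[s^{K_j}_{j,m_j}](q,p)` with ANY member indices `m_j ≥ j + 1` and ANY frames `K_j` with `FrameOK R U (nScales β) μ K_j` in the regime
(`klBetaMin ≤ β ≤ e^{c/U²}`, `β ≤ L`, `A = 2Gfr₀|U| + 2Gfr₁U² + Gfr₂·c/log 4 ≤ 2`), and a total momentum `Q` in the pair class at resolution `J + 7` (`J ≤ n_β`):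
* §1 `klsf_pi_div_beta_le` (`j ≤ n_β ⇒ π/β ≤ 2Λ_j`), `klsf_soft_mem` (`0 ≤ s_{n,m} ≤ 1 − w_{Λ_n}`), `klsf_abs_mass_le` (`|W_q(j)| ≤ 2¹⁶`), `klsf_card_edge_le`;
* §2 `klsf_shortfall_assembly` — the bookkeeping with scale `0` counted as an EDGE scale (the deep row asks `1 ≤ j`):
  deep `1 ≤ j ≤ J`: `≤ C(s/Λ_j)²`; edge `j = 0` or `J < j < m`: `≤ 2b` ⟹ `Σ_{j<m} ≤ (16/15)C(s/Λ_J)² + 2b·((m − (J+1)) + 1)`;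
* §3 **`klsf_shortfall_le`** (`C = 141376400000`, `s = |p_Q|_𝕋`, `b = 2¹⁶`) and **`klsf_shortfall_le_numeric`**: `(|p_Q|_𝕋/Λ_J)² ≤ 2⁻¹⁸` in the class ⟹
  **`Σ_{j<m} (W₀(j) − W_Q(j)) ≤ 575263 + 131072·((m − (J+1)) + 1)`** — `Θ` BY VALUE, uniform in `β, L, M`, the frames and the member indices (in the cascade's use
  `m ≤ J + 8`, so `Θ ≤ 575263 + 2²⁰`; the constants are the crude ones of rows 25b/p1's envelope and are E1's to sharpen).
* §4 **`klsf_shortfall_uniform`**: class at ANY resolution `N ≤ n_β + 7`, steps `m ≤ N + 1` ⟹ `Σ_{j<m} (W₀(j) − W_Q(j)) ≤ 1623839` — row 17's `Θ` as ONE NUMBER.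
Pure composition; no definitions; nothing asserts any slot, stub, K3 or SC.  References: the rows composed [folklore]; frame sizes [cite: BenfattoGiulianiMastropietro2006, §2.4 (2.36)].
-/

noncomputable section

namespace Summit.HubbardSuperconductivity.HubbardSuperconductivity.Theorems.KLRegimeSplit

set_option linter.dupNamespace false -- summit = problem name (single-conjunct summit), D-0017

open Real Finset Literature.MathematicalPhysics.QuantumLattice Literature.Probability.LatticeModels
open Summit.HubbardSuperconductivity.HubbardSuperconductivity.Theorems.KLProgrammeLegKernels
open Summit.HubbardSuperconductivity.HubbardSuperconductivity.Theorems.DispersionFlow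
open Summit.HubbardSuperconductivity.HubbardSuperconductivity.Theorems.PerturbedFermiCurve

/-! ## §1 Small facts -/

section Facts

variable {L M : ℕ} [NeZero L] (β μ : ℝ) (K : TrigPolyC4v)

omit [NeZero L] in
/-- Above the thermal scale: `klBetaMin ≤ β`, `j ≤ n_β` ⟹ `π/β ≤ 2Λ_j` (`(π/β)/Λ_j ≤ 4^{−(n_β−j)} ≤ 1`). [folklore] -/
theorem klsf_pi_div_beta_le {β : ℝ} (hβ : klBetaMin ≤ β) {j : ℕ} (hj : j ≤ nScales β) : Real.pi / β ≤ 2 * klScale klE0 j := by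
  have hΛ := klth_klScale_pos j
  have h := klth_ratio_le_inv_pow hβ hj
  have h1 : ((4 : ℝ) ^ (nScales β - j))⁻¹ ≤ 1 := inv_le_one_of_one_le₀ (one_le_pow₀ (by norm_num))
  have h2 : Real.pi / β / klScale klE0 j ≤ 1 := h.trans h1
  rw [div_le_iff₀ hΛ] at h2
  linarith

omit [NeZero L] in
/-- The complementary member is an admissible symbol at its scale: `n ≤ m` ⟹ `0 ≤ s_{n,m}(k) ≤ 1 − w^K_{Λ_n}(k)`. [folklore] -/
theorem klsf_soft_mem [NeZero M] {n m : ℕ} (hnm : n ≤ m) (k : FreqMomentum L M) :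
    0 ≤ softSymbolCompl L M β μ K n m k ∧ softSymbolCompl L M β μ K n m k ≤ 1 - hubbardCutoffWeightCT L M β μ K (klScale klE0 n) k := by
  have h := softSymbolCompl_sub_compl_mem β μ K n hnm k
  simpa [softSymbolCompl_self] using h

/-- **The mass envelope at any transfer**: `FrameOK`, `klBetaMin ≤ β ≤ L`, `n ≤ m` ⟹ `|Σ_p t_n[s_{n,m}](Q,p)| ≤ 2¹⁶` (p1's `sum_abs_klTransferWeight_le_of_frameOK`). [folklore] -/
theorem klsf_abs_mass_le [NeZero M] {R : RenConsts} {U : ℝ} {N : ℕ} (hK : FrameOK R U N μ K) (hβ : klBetaMin ≤ β) (hβL : β ≤ L)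
    {n m : ℕ} (hnm : n ≤ m) (Q : TorusSite 2 L) :
    |∑ p, klTransferWeight L M β μ K n (softSymbolCompl L M β μ K n m) Q p| ≤ 2 ^ 16 :=
  (abs_sum_le_sum_abs _ _).trans (sum_abs_klTransferWeight_le_of_frameOK hK hβ hβL n (fun k => klsf_soft_mem β μ K hnm k) Q)

omit [NeZero L] in
/-- The edge scales among `j < m` — scale `0` and the scales beyond `J` — number at most `(m − (J+1)) + 1`. [folklore] -/
theorem klsf_card_edge_le (J m : ℕ) : ((range m).filter fun j => j = 0 ∨ J < j).card ≤ (m - (J + 1)) + 1 := by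
  classical
  calc ((range m).filter fun j => j = 0 ∨ J < j).card
      ≤ (((range m).filter fun j => j = 0) ∪ ((range m).filter fun j => J < j)).card := by
        refine card_le_card fun j hj => ?_
        rw [mem_filter] at hj
        rw [mem_union, mem_filter, mem_filter]
        rcases hj.2 with h | h
        · exact Or.inl ⟨hj.1, h⟩
        · exact Or.inr ⟨hj.1, h⟩
    _ ≤ ((range m).filter fun j => j = 0).card + ((range m).filter fun j => J < j).card := card_union_le _ _
    _ ≤ 1 + (m - (J + 1)) := by
        refine Nat.add_le_add ?_ ?_
        · calc ((range m).filter fun j => j = 0).card ≤ ({0} : Finset ℕ).card :=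
              card_le_card fun j hj => by rw [mem_filter] at hj; rw [mem_singleton]; exact hj.2
            _ = 1 := card_singleton 0
        · have hsub : ((range m).filter fun j => J < j) ⊆ Ico (J + 1) m := fun j hj => by
            rw [mem_filter, mem_range] at hj; rw [mem_Ico]; omega
          exact (card_le_card hsub).trans (by rw [Nat.card_Ico])
    _ = (m - (J + 1)) + 1 := by ring

end Facts

/-! ## §2 The bookkeeping with scale `0` as an edge scale -/

/-- **Shortfall assembly**: deep scales `1 ≤ j ≤ J` with `W₀ j − W_q j ≤ C(s/Λ_j)²`, edge scales (`j = 0` or `J < j < m`) with `W₀ j − W_q j ≤ 2b` ⟹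
`Σ_{j<m}(W₀ j − W_q j) ≤ (16/15)C(s/Λ_J)² + 2b·((m − (J+1)) + 1)`. [folklore] -/
theorem klsf_shortfall_assembly (W₀ Wq : ℕ → ℝ) {C s b : ℝ} (hC : 0 ≤ C) (hb : 0 ≤ b) (J m : ℕ)
    (hdeep : ∀ j, 1 ≤ j → j ≤ J → W₀ j - Wq j ≤ C * (s / klScale klE0 j) ^ 2)
    (hedge : ∀ j, j < m → (j = 0 ∨ J < j) → W₀ j - Wq j ≤ 2 * b) :
    ∑ j ∈ range m, (W₀ j - Wq j) ≤ 16 / 15 * C * (s / klScale klE0 J) ^ 2 + 2 * b * (((m - (J + 1) : ℕ) : ℝ) + 1) := by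
  classical
  have hsplit : ∑ j ∈ range m, (W₀ j - Wq j) =
      ∑ j ∈ (range m).filter (fun j => j = 0 ∨ J < j), (W₀ j - Wq j) + ∑ j ∈ (range m).filter (fun j => ¬ (j = 0 ∨ J < j)), (W₀ j - Wq j) :=
    (sum_filter_add_sum_filter_not _ _ _).symm
  rw [hsplit, add_comm]
  refine add_le_add ?_ ?_
  · -- deep part
    calc ∑ j ∈ (range m).filter (fun j => ¬ (j = 0 ∨ J < j)), (W₀ j - Wq j)
        ≤ ∑ j ∈ (range m).filter (fun j => ¬ (j = 0 ∨ J < j)), C * (s / klScale klE0 j) ^ 2 :=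
          sum_le_sum fun j hj => by
            simp only [mem_filter, not_or, not_lt] at hj
            exact hdeep j (by omega) hj.2.2
      _ ≤ ∑ j ∈ range (J + 1), C * (s / klScale klE0 j) ^ 2 := by
          refine sum_le_sum_of_subset_of_nonneg (fun j hj => ?_) fun j _ _ => by positivity
          simp only [mem_filter, not_or, not_lt] at hj
          exact mem_range.2 (by omega)
      _ = C * ∑ j ∈ range (J + 1), (s / klScale klE0 j) ^ 2 := (mul_sum _ _ _).symm
      _ ≤ C * (16 / 15 * (s / klScale klE0 J) ^ 2) := mul_le_mul_of_nonneg_left (klds_sum_sq_div_klScale_le s J) hC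
      _ = 16 / 15 * C * (s / klScale klE0 J) ^ 2 := by ring
  · -- edge part
    calc ∑ j ∈ (range m).filter (fun j => j = 0 ∨ J < j), (W₀ j - Wq j)
        ≤ ∑ j ∈ (range m).filter (fun j => j = 0 ∨ J < j), 2 * b :=
          sum_le_sum fun j hj => by rw [mem_filter, mem_range] at hj; exact hedge j hj.1 hj.2
      _ = 2 * b * ((range m).filter (fun j => j = 0 ∨ J < j)).card := by rw [sum_const, nsmul_eq_mul]; ring
      _ ≤ 2 * b * (((m - (J + 1) : ℕ) : ℝ) + 1) := by
          refine mul_le_mul_of_nonneg_left ?_ (by positivity)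
          exact_mod_cast klsf_card_edge_le J m

/-! ## §3 The (D2) shortfall by value -/

section Shortfall

variable {L M : ℕ} [NeZero L] (β μ : ℝ)
variable {R : RenConsts} (hR : ∀ j, 0 ≤ R.Gfr j) {U c : ℝ} (hc : 0 ≤ c) (hβmin : klBetaMin ≤ β) (hβc : β ≤ Real.exp (c / U ^ 2))
  (hA2 : 2 * R.Gfr 0 * |U| + 2 * R.Gfr 1 * U ^ 2 + R.Gfr 2 * (c / Real.log 4) ≤ 2)
  {Kf : ℕ → TrigPolyC4v} (hKf : ∀ j, FrameOK R U (nScales β) μ (Kf j)) {mf : ℕ → ℕ} (hmf : ∀ j, j + 1 ≤ mf j)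
include hR hc hβmin hβc hA2 hKf hmf

/-- **THE (D2) SHORTFALL BY VALUE** (module docstring): in the pair class at resolution `J + 7` (`J ≤ n_β`), for any frames `K_j` (`FrameOK`, regime, `A ≤ 2`) and
member indices `m_j ≥ j + 1`, `Σ_{j<m} (W₀(j) − W_Q(j)) ≤ (16/15)·141376400000·(|p_Q|_𝕋/Λ_J)² + 2·2¹⁶·((m − (J+1)) + 1)` with
`W_q(j) = −Σ_p t_j^{K_j}[s^{K_j}_{j,m_j}](q,p)`. [folklore] -/
theorem klsf_shortfall_le [NeZero M] (hβL : β ≤ L) {Q : TorusSite 2 L} {J : ℕ} (hQ : IsPairClassAt L Q (J + 7)) (hJ : J ≤ nScales β) (m : ℕ) :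
    ∑ j ∈ range m,
        (-∑ p, klTransferWeight L M β μ (Kf j) j (softSymbolCompl L M β μ (Kf j) j (mf j)) 0 p -
          -∑ p, klTransferWeight L M β μ (Kf j) j (softSymbolCompl L M β μ (Kf j) j (mf j)) Q p) ≤
      16 / 15 * 141376400000 * (klTorusNorm L Q / klScale klE0 J) ^ 2 + 2 * 2 ^ 16 * (((m - (J + 1) : ℕ) : ℝ) + 1) := by
  have hβ0 : 0 < β := lt_of_lt_of_le (by norm_num [klBetaMin]) hβmin
  refine klsf_shortfall_assembly _ _ (by norm_num) (by norm_num) J m (fun j hj1 hjJ => ?_) (fun j _ _ => ?_)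
  · -- deep scale `1 ≤ j ≤ J`
    have hclass : IsPairClassAt L Q (j + 7) := isPairClassAt_mono (h := hQ) (hjn := by omega)
    have hdeep := klrg_deep_of_isPairClassAt_seven (L := L) hR hc hA2 hclass
    have hΛβ : Real.pi / β ≤ 2 * klScale klE0 j := klsf_pi_div_beta_le hβmin (hjJ.trans hJ)
    have h := klrg_abs_sum_klTransferWeight_sub_pin_le_numeric (M := M) β μ hR hc hβmin hβc (hKf j) hA2 hβ0 hβL hj1 (hmf j) hΛβ Q hdeep
    have hle := le_abs_self (∑ p, klTransferWeight L M β μ (Kf j) j (softSymbolCompl L M β μ (Kf j) j (mf j)) Q p -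
      ∑ p, klTransferWeight L M β μ (Kf j) j (softSymbolCompl L M β μ (Kf j) j (mf j)) 0 p)
    linarith
  · -- edge scale: the envelope twice
    have hjm : j ≤ mf j := by have := hmf j; omega
    have h0 := klsf_abs_mass_le β μ (Kf j) (M := M) (hKf j) hβmin hβL hjm 0
    have hQ' := klsf_abs_mass_le β μ (Kf j) (M := M) (hKf j) hβmin hβL hjm Q
    have h1 := neg_abs_le (∑ p, klTransferWeight L M β μ (Kf j) j (softSymbolCompl L M β μ (Kf j) j (mf j)) 0 p)
    have h2 := le_abs_self (∑ p, klTransferWeight L M β μ (Kf j) j (softSymbolCompl L M β μ (Kf j) j (mf j)) Q p)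
    linarith

/-- **THE (D2) SHORTFALL, NUMERIC**: in the class `|p_Q|_𝕋 ≤ 4^{−(J+7)}`, so `(|p_Q|_𝕋/Λ_J)² ≤ 2⁻¹⁸` and
**`Σ_{j<m} (W₀(j) − W_Q(j)) ≤ 575263 + 131072·((m − (J+1)) + 1)`** — `Θ` by value. [folklore] -/
theorem klsf_shortfall_le_numeric [NeZero M] (hβL : β ≤ L) {Q : TorusSite 2 L} {J : ℕ} (hQ : IsPairClassAt L Q (J + 7)) (hJ : J ≤ nScales β)
    (m : ℕ) :
    ∑ j ∈ range m,
        (-∑ p, klTransferWeight L M β μ (Kf j) j (softSymbolCompl L M β μ (Kf j) j (mf j)) 0 p -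
          -∑ p, klTransferWeight L M β μ (Kf j) j (softSymbolCompl L M β μ (Kf j) j (mf j)) Q p) ≤
      575263 + 131072 * (((m - (J + 1) : ℕ) : ℝ) + 1) := by
  have h := klsf_shortfall_le β μ hR hc hβmin hβc hA2 hKf hmf (M := M) hβL hQ hJ m
  have hs : klTorusNorm L Q ≤ ((4 : ℝ) ^ (J + 7))⁻¹ := klbj_klTorusNorm_le_of_isPairClassAt hQ
  have hs0 : 0 ≤ klTorusNorm L Q := EngineV8.klband_klTorusNorm_nonneg (L := L) Q
  have hΛ : klScale klE0 J = 1 / 32 * ((4 : ℝ) ^ J)⁻¹ := by simp [klScale, klE0]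
  have hΛpos : 0 < klScale klE0 J := klth_klScale_pos J
  have hratio : klTorusNorm L Q / klScale klE0 J ≤ 1 / 512 := by
    rw [div_le_iff₀ hΛpos, hΛ]
    have h4 : (0 : ℝ) < (4 : ℝ) ^ J := by positivity
    calc klTorusNorm L Q ≤ ((4 : ℝ) ^ (J + 7))⁻¹ := hs
      _ = 1 / 512 * (1 / 32 * ((4 : ℝ) ^ J)⁻¹) := by rw [pow_add]; field_simp; norm_num
  have hratio0 : 0 ≤ klTorusNorm L Q / klScale klE0 J := by positivity
  have hsq : (klTorusNorm L Q / klScale klE0 J) ^ 2 ≤ (1 / 512) ^ 2 := pow_le_pow_left₀ hratio0 hratio 2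
  have hnum : 16 / 15 * 141376400000 * (klTorusNorm L Q / klScale klE0 J) ^ 2 ≤ 575263 := by
    have := mul_le_mul_of_nonneg_left hsq (by norm_num : (0 : ℝ) ≤ 16 / 15 * 141376400000)
    linarith [this]
  linarith

/-! ## §4 The uniform shortfall: one number for every class and every step -/

/-- **THE (D2) SHORTFALL, UNIFORM**: for a total momentum in the pair class at ANY resolution `N ≤ n_β + 7` and any number of steps `m ≤ N + 1`
(the steps at which the class is still alive), **`Σ_{j<m} (W₀(j) − W_Q(j)) ≤ 1623839`** (`= 575263 + 8·2¹⁷`; for `N < 7` every scale is an edge scale and the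
envelope alone gives `≤ 7·2¹⁷`).  This is row 17's `Θ` as ONE NUMBER. [folklore] -/
theorem klsf_shortfall_uniform [NeZero M] (hβL : β ≤ L) {Q : TorusSite 2 L} {N : ℕ} (hQ : IsPairClassAt L Q N) (hN : N ≤ nScales β + 7)
    {m : ℕ} (hm : m ≤ N + 1) :
    ∑ j ∈ range m,
        (-∑ p, klTransferWeight L M β μ (Kf j) j (softSymbolCompl L M β μ (Kf j) j (mf j)) 0 p -
          -∑ p, klTransferWeight L M β μ (Kf j) j (softSymbolCompl L M β μ (Kf j) j (mf j)) Q p) ≤ 1623839 := by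
  by_cases hN7 : 7 ≤ N
  · -- deep + edge bookkeeping with `J = N − 7`
    obtain ⟨J, rfl⟩ : ∃ J, N = J + 7 := ⟨N - 7, by omega⟩
    have hJ : J ≤ nScales β := by omega
    have h := klsf_shortfall_le_numeric β μ hR hc hβmin hβc hA2 hKf hmf (M := M) hβL hQ hJ m
    have hcount : (((m - (J + 1) : ℕ) : ℝ) + 1) ≤ 8 := by
      have : (m - (J + 1) : ℕ) ≤ 7 := by omega
      have : ((m - (J + 1) : ℕ) : ℝ) ≤ 7 := by exact_mod_cast this
      linarith
    nlinarith
  · -- every scale is an edge scale: the envelope twice, `m ≤ 7` times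
    rw [not_le] at hN7
    have hm7 : m ≤ 7 := by omega
    have hterm : ∀ j ∈ range m,
        (-∑ p, klTransferWeight L M β μ (Kf j) j (softSymbolCompl L M β μ (Kf j) j (mf j)) 0 p -
          -∑ p, klTransferWeight L M β μ (Kf j) j (softSymbolCompl L M β μ (Kf j) j (mf j)) Q p) ≤ 2 * 2 ^ 16 := by
      intro j _
      have hjm : j ≤ mf j := by have := hmf j; omega
      have h0 := klsf_abs_mass_le β μ (Kf j) (M := M) (hKf j) hβmin hβL hjm 0
      have hQ' := klsf_abs_mass_le β μ (Kf j) (M := M) (hKf j) hβmin hβL hjm Q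
      have h1 := neg_abs_le (∑ p, klTransferWeight L M β μ (Kf j) j (softSymbolCompl L M β μ (Kf j) j (mf j)) 0 p)
      have h2 := le_abs_self (∑ p, klTransferWeight L M β μ (Kf j) j (softSymbolCompl L M β μ (Kf j) j (mf j)) Q p)
      linarith
    calc ∑ j ∈ range m,
          (-∑ p, klTransferWeight L M β μ (Kf j) j (softSymbolCompl L M β μ (Kf j) j (mf j)) 0 p -
            -∑ p, klTransferWeight L M β μ (Kf j) j (softSymbolCompl L M β μ (Kf j) j (mf j)) Q p)
        ≤ ∑ j ∈ range m, (2 * 2 ^ 16 : ℝ) := sum_le_sum hterm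
      _ = 2 * 2 ^ 16 * m := by rw [sum_const, card_range, nsmul_eq_mul]; ring
      _ ≤ 2 * 2 ^ 16 * 7 := by gcongr; exact_mod_cast hm7
      _ ≤ 1623839 := by norm_num

end Shortfall

end Summit.HubbardSuperconductivity.HubbardSuperconductivity.Theorems.KLRegimeSplit

end
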